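import Literature.Geometry.Lorentzian.KerrBoyerLindquistData
import Literature.Geometry.Lorentzian.KerrBoyerLindquistExtrinsicDecay
import Literature.Geometry.Lorentzian.ModelDataProofs
import Literature.Geometry.Lorentzian.StronglyAsymptoticallyFlatADMEnergy
import Literature.Geometry.Lorentzian.StronglyAsymptoticallyFlatADMMomentum
import Literature.Geometry.Lorentzian.AsymptoticFlatnessProofs
import Literature.Geometry.Lorentzian.HarmonicallyFlatDecay
import HarnessLib

/-!
# The Boyer–Lindquist Kerr data are Dafermos–Rodnianski admissible, with ADM energy `M`

Continuing `KerrBoyerLindquistData.lean`: on the inclusion end `Kerr.BL.blEnd ρ₁` (chart the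
identity beyond `max ρ₁ 0 + 1`) the chart components of the Boyer–Lindquist Kerr data
`Kerr.BL.blData` are the closed forms `blHRepCLM` and `kRepCLM` (`hCoeff_blEnd_eq`,
`kCoeff_blEnd_eq`), so the decay estimates `h − (1 + 2M/ρ)δ = O₂(ρ⁻²)`
(`isBigOSmooth_blHRepCLM_sub`) and `k = O₂(ρ⁻³)` (`isBigOSmooth_kRepCLM`) give **strong asymptotic
flatness in the sense of Dafermos–Rodnianski with mass parameter `M`**
(`isStronglyAsymptoticallyFlatDR_blData`), hence asymptotic flatness of order one, ADM energy `M`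
and vanishing ADM linear momentum (`isAsymptoticallyFlat_blData`, `admEnergy_blData`,
`admMomentum_blData`): the rest-frame Kerr slice of arbitrary spin, in the admissible class.

References: Brandt–Seidel, Phys. Rev. D 54 (1996) 1403, §II; M. Dafermos, I. Rodnianski, Clay
lecture notes (2013), App. B.2.3; R. Bartnik, CPAM 39 (1986), Def. 2.1 and (4.2);
Arnowitt–Deser–Misner 1962.
-/

noncomputable section

-- instance search through the nested operator types `E3 →L[ℝ] E3 →L[ℝ] ℝ`
set_option maxSynthPendingDepth 3

open Bundle TopologicalSpace Set Module Real Filter Function Asymptotics Bornology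
open scoped InnerProductSpace Topology ContDiff Manifold

namespace Literature.Geometry.Lorentzian

/-! ### Chart components of `k` on an inclusion end -/

section InclusionEnd

variable (V : Opens E3) (R : ℝ) (hR : 0 < R) (hV : ∀ x : E3, R < ‖x‖ → x ∈ V)

/-- **The chart components of `k` on an inclusion end are the values of `k`**: for `R < ‖x‖`,
`kCoeff (inclusionAFEnd V R hR hV) D x v w = k_x(v, w)` (companion of
`hCoeff_inclusionAFEnd_apply`). Bartnik 1986, Def. 2.1, p. 675; Christodoulou–Klainerman 1993,
(1.0.9). [cite: Bartnik1986, Def. 2.1 p. 675] -/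
theorem kCoeff_inclusionAFEnd_apply (D : InitialDataSet (𝓡 3) V) {x : E3} (hx : R < ‖x‖)
    (v w : E3) :
    AFEnd.kCoeff (inclusionAFEnd V R hR hV) D x v w = D.k ⟨x, hV x hx⟩ v w := by
  have hx' : (inclusionAFEnd V R hR hV).R < ‖x‖ := hx
  rw [AFEnd.kCoeff_of_lt (e := inclusionAFEnd V R hR hV) D hx']
  have key : ∀ (p : V) (_ : p = ⟨x, hV x hx⟩) (v' : E3) (_ : v' = v) (w' : E3) (_ : w' = w),
      D.k p v' w' = D.k ⟨x, hV x hx⟩ v w := by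
    rintro p rfl v' rfl w' rfl
    rfl
  exact (pullbackBilin_apply (I := 𝓡 3) (I' := 𝓡 3) _ _ _ v w).trans
    (key _ rfl _ (mfderiv_dataChart_inclusionAFEnd_apply V R hR hV _ v) _
      (mfderiv_dataChart_inclusionAFEnd_apply V R hR hV _ w))

end InclusionEnd

namespace Kerr.BL

open Kerr.Ingoing InitialDataSet

variable {M a ρ₁ : ℝ}

/-! ### The end of the Boyer–Lindquist data -/

/-- Beyond `max ρ₁ 0 + 1` every point lies in the slice `Kerr.slice 0 ρ₁`. [folklore] -/
theorem mem_slice_of_lt {x : E3} (hx : max ρ₁ 0 + 1 < ‖x‖) : x ∈ slice 0 ρ₁ :=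
  mem_slice_zero_iff.2 (by linarith)

variable (ρ₁) in
/-- **The end of the Boyer–Lindquist data**: the inclusion end of `Kerr.slice 0 ρ₁` with inner
radius `max ρ₁ 0 + 1` (chart the identity). Bartnik 1986, §1. [cite: Bartnik1986, §1] -/
def blEnd : AFEnd (slice 0 ρ₁) :=
  inclusionAFEnd (slice 0 ρ₁) (max ρ₁ 0 + 1) (by positivity) fun _ hx ↦ mem_slice_of_lt hx

/-- The inner radius of the end. [cite: Bartnik1986, §1] -/
@[simp]
theorem blEnd_R : (blEnd ρ₁).R = max ρ₁ 0 + 1 := rfl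

/-- **The chart components of the metric are `blHRepCLM`** beyond the inner radius.
[cite: BrandtSeidel1996, §II] -/
theorem hCoeff_blEnd_eq (hM : 0 ≤ M) (hρ₁ : rhoH M a ≤ ρ₁) {x : E3} (hx : max ρ₁ 0 + 1 < ‖x‖) :
    AFEnd.hCoeff (blEnd ρ₁) (blData hM hρ₁) x = blHRepCLM M a x := by
  ext v w
  exact hCoeff_inclusionAFEnd_apply (slice 0 ρ₁) (max ρ₁ 0 + 1) (by positivity)
    (fun _ hx ↦ mem_slice_of_lt hx) (blData hM hρ₁) hx v w

/-- **The chart components of `k` are `kRepCLM`** beyond the inner radius. [cite: BrandtSeidel1996, §II] -/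
theorem kCoeff_blEnd_eq (hM : 0 ≤ M) (hρ₁ : rhoH M a ≤ ρ₁) {x : E3} (hx : max ρ₁ 0 + 1 < ‖x‖) :
    AFEnd.kCoeff (blEnd ρ₁) (blData hM hρ₁) x = kRepCLM M a x := by
  ext v w
  exact kCoeff_inclusionAFEnd_apply (slice 0 ρ₁) (max ρ₁ 0 + 1) (by positivity)
    (fun _ hx ↦ mem_slice_of_lt hx) (blData hM hρ₁) hx v w

/-! ### Dafermos–Rodnianski admissibility and the ADM energy -/

/-- **The Boyer–Lindquist Kerr data are strongly asymptotically flat in the sense of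
Dafermos–Rodnianski, with mass parameter `M`** (`0 ≤ M`, any spin `a`, `ρ₁ ≥ ρH`): in the chart of
the inclusion end `h − (1 + 2M/ρ)δ = O₂(ρ⁻²) = o₂(ρ⁻¹)` and `k = O₁(ρ⁻³) = o₁(ρ⁻²)`.
Dafermos–Rodnianski 2013, App. B.2.3; Brandt–Seidel 1996, §II. [cite: DafermosRodnianski2013, App. B.2.3] -/
theorem isStronglyAsymptoticallyFlatDR_blData (hM : 0 ≤ M) (hρ₁ : rhoH M a ≤ ρ₁) :
    (blEnd ρ₁).IsStronglyAsymptoticallyFlatDR (blData hM hρ₁) M := by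
  refine ⟨fun m hm ↦ ?_, fun m hm ↦ ?_⟩
  · -- the metric part
    have hs : IsBigOSmooth 2 (-2) fun y : E3 ↦
        AFEnd.hCoeff (blEnd ρ₁) (blData hM hρ₁) y -
          (1 + 2 * M / ‖y‖) • (innerSL ℝ : E3 →L[ℝ] E3 →L[ℝ] ℝ) :=
      (isBigOSmooth_blHRepCLM_sub M a).congr_far (R₁ := max ρ₁ 0 + 1) fun y hy ↦ by
        rw [hCoeff_blEnd_eq hM hρ₁ hy]
    exact (hs.isBigO hm).trans_isLittleO
      (isLittleO_norm_rpow_rpow_cobounded (E := E3) (by linarith))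
  · -- the `k` part
    have hs : IsBigOSmooth 1 (-3) fun y : E3 ↦ AFEnd.kCoeff (blEnd ρ₁) (blData hM hρ₁) y :=
      ((isBigOSmooth_kRepCLM hM a).of_le one_le_two).congr_far (R₁ := max ρ₁ 0 + 1)
        fun y hy ↦ by rw [kCoeff_blEnd_eq hM hρ₁ hy]
    exact (hs.isBigO hm).trans_isLittleO
      (isLittleO_norm_rpow_rpow_cobounded (E := E3) (by linarith))

/-- **The Boyer–Lindquist Kerr data are asymptotically flat of order one** on their end
(`h − δ = O₂(ρ⁻¹)`, `k = O₁(ρ⁻²)`). Bartnik 1986, Def. 2.1. [cite: Bartnik1986, Def. 2.1] -/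
theorem isAsymptoticallyFlat_blData (hM : 0 ≤ M) (hρ₁ : rhoH M a ≤ ρ₁) :
    (blEnd ρ₁).IsAsymptoticallyFlat (blData hM hρ₁) 1 :=
  AFEnd.IsStronglyAsymptoticallyFlatDR.IsAsymptoticallyFlat_one_holds (blEnd ρ₁) (blData hM hρ₁)
    (isStronglyAsymptoticallyFlatDR_blData hM hρ₁)

/-- **The Boyer–Lindquist Kerr data have ADM energy `M`.** Arnowitt–Deser–Misner 1962; Bartnik 1986,
(4.2). [cite: Bartnik1986, §4, (4.2)] -/
theorem hasADMEnergy_blData (hM : 0 ≤ M) (hρ₁ : rhoH M a ≤ ρ₁) :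
    (blEnd ρ₁).HasADMEnergy (blData hM hρ₁) M :=
  (isStronglyAsymptoticallyFlatDR_blData hM hρ₁).hasADMEnergy

/-- **The ADM energy of the Boyer–Lindquist Kerr data is the mass parameter `M`.**
Bartnik 1986, (4.2); Dafermos–Rodnianski 2013, App. B.2.3. [cite: Bartnik1986, §4, (4.2)] -/
theorem admEnergy_blData (hM : 0 ≤ M) (hρ₁ : rhoH M a ≤ ρ₁) :
    (blEnd ρ₁).admEnergy (blData hM hρ₁) = M :=
  (isStronglyAsymptoticallyFlatDR_blData hM hρ₁).admEnergy_eq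

/-- **The ADM linear momentum of the Boyer–Lindquist Kerr data vanishes** (the slice is at rest).
Dafermos–Rodnianski 2013, App. B.2.3. [cite: DafermosRodnianski2013, App. B.2.3] -/
theorem admMomentum_blData (hM : 0 ≤ M) (hρ₁ : rhoH M a ≤ ρ₁) (i : Fin 3) :
    (blEnd ρ₁).admMomentum (blData hM hρ₁) i = 0 :=
  (isStronglyAsymptoticallyFlatDR_blData hM hρ₁).admMomentum_eq_zero i

end Kerr.BL

end Literature.Geometry.Lorentzian

end
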